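import Literature.Analysis.FluidPDE.GIPGlobalStabilityProofs
import Literature.Analysis.FluidPDE.KatoGlobalSmallHolds
import Literature.Analysis.FluidPDE.NSKatoToClayHolds
import Mathlib.Analysis.SpecialFunctions.JapaneseBracket
import HarnessLib

/-!
# Barrier: in a continuity / «continuous induction» / clopen argument on the data, CLOSEDNESS of
# the set of good data IS the regularity problem (openness is Gallagher–Iftimie–Planchon 2003)

Barrier catalogue entry for `NavierStokesRegularity` (D-0021), METHOD LEVEL, everything PROVED
(zero fact debt: it rests on the tree's DISCHARGED facts `GIP2003_L3_stability_holds`,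
`kato_global_small_holds`, `clay_solution_of_hasGlobalKatoSolution_holds`).

A recurring proof scheme («continuous induction», «the set of good data / good times is open and
closed, hence everything») splits global regularity into

* OPENNESS of the set `G_ν = {u₀ ∈ L³_σ(ℝ³) : u₀ has a global (Kato) mild solution}` — a
  THEOREM: stability of global solutions, Gallagher–Iftimie–Planchon, Ann. Inst. Fourier 53 (2003),
  Thm. 0.1 (in the tree `Literature.Analysis.FluidPDE.GIP2003_L3_stability`, discharged, with the
  corollary `GIP2003_L3_stability.exists_ball_hasGlobalKatoSolution`), plus `0 ∈ G_ν` (Kato 1984,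
  small data, `kato_global_small_holds`);
* CLOSEDNESS of `G_ν` (under `L³` limits, or merely along each ray `s ↦ s u₀`, `s ∈ ℝ`), which
  the scheme then tries to obtain from an a priori bound with a data-independent constant.

This file proves that the second half is not a lemma but the whole problem:
`hasGlobalKatoSolution_of_isClosed_ray` — if the set of parameters `{s : ℝ | s u₀ ∈ G_ν}` is
closed for ONE weakly divergence-free `u₀ ∈ L³`, then `u₀ ∈ G_ν` (connectedness of `ℝ`: the set is
open by GIP, closed by hypothesis, contains `0`); hence (`forall_isClosed_ray_iff_forall_global`)
«every ray-section of `G_ν` is closed» is EQUIVALENT to «every weakly divergence-free `L³` datum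
has a global Kato solution», and (`clayA_of_forall_isClosed_ray`) implies the Clay (A) conclusion —
smooth bounded-energy solutions on `ℝ³ × [0,∞)` — for every smooth divergence-free rapidly
decaying datum (Kato ⇒ Clay upgrade, `clay_solution_of_hasGlobalKatoSolution_holds`).

Typed instances on the NS-CLAIMS map (D-0090): the «`G_p` is open and closed» continuous-induction
argument (arXiv:1204.5040v2 §4, Assertions 1–2 — its openness step even fails at the abstract grain,
`Summit.….Theorems.Cui2012.not_Assertion1Inference`, because the set is cut out by a NON-strict
a priori bound with a fixed constant; the honest open set is GIP's), and the «open map with closed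
range on a Bochner–Sobolev scale» argument (arXiv:2009.10530v2, Cor. 2.12 / Thm. 3.1: range closed
⇔ everything; the closedness estimate (3.13) is the refuted step). In both, the printed closedness
step is an a priori estimate in a critical or subcritical norm, uniform on bounded sets of data —
exactly what this barrier says cannot be cheaper than regularity itself.

## References

* I. Gallagher, D. Iftimie, F. Planchon, *Asymptotics and stability for global solutions to the
  Navier–Stokes equations*, Ann. Inst. Fourier 53 (2003) 1387–1424, Thm. 0.1 (p. 1389), §3 p. 1398
  («the set of initial data … generating a global solution is open»). [`GallagherIftimiePlanchon2003`]
* T. Kato, *Strong `L^p`-solutions of the Navier–Stokes equation in `ℝ^m`*, Math. Z. 187 (1984)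
  471–480, Thms. 2 and 4. [`Kato1984MathZ`]

WHAT THIS IS NOT: not a claim about NS regularity or blow-up; not a claim about any author beyond
the typed locator.
-/

noncomputable section

open MeasureTheory Set Function Filter Topology
open scoped ENNReal

namespace Literature.Barriers.NavierStokesRegularity

open Literature.Analysis.FluidPDE

/-! ## The two theorems the scheme's OPEN half rests on -/

/-- **The zero datum is globally regular** (`0 ∈ G_ν`): for `ν > 0` the zero field has a global
Kato solution (Kato 1984, small data — `kato_global_small_holds` at `‖0‖_{L³} = 0`).
[cite: Kato1984MathZ, Thm. 2 (p. 472)] -/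
theorem hasGlobalKatoSolution_zero {ν : ℝ} (hν : 0 < ν) :
    HasGlobalKatoSolution ν (0 : EuclideanSpace ℝ (Fin 3) → EuclideanSpace ℝ (Fin 3)) := by
  obtain ⟨δ, hδ, h⟩ := kato_global_small_holds
  have h0 : MemLp (0 : EuclideanSpace ℝ (Fin 3) → EuclideanSpace ℝ (Fin 3)) 3 volume :=
    MemLp.zero
  have hdiv : IsWeaklyDivFree (0 : EuclideanSpace ℝ (Fin 3) → EuclideanSpace ℝ (Fin 3)) := by
    intro φ hφ
    simp
  obtain ⟨u, hg, hcont, hu0, hm, -, -⟩ := h ν hν 0 h0 hdiv (by simp)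
  exact ⟨u, hg, hcont, hu0, hm⟩

/-- **Openness of `G_ν` along a ray** (GIP 2003 Thm. 0.1 (ii), tree
`GIP2003_L3_stability.exists_ball_hasGlobalKatoSolution`): if `x u₀ ∈ G_ν` then `s u₀ ∈ G_ν` for
all `s` near `x` (`‖x u₀ − s u₀‖_{L³} = |x − s| ‖u₀‖_{L³}`).
[cite: GallagherIftimiePlanchon2003, Thm. 0.1 (p. 1389) and §3 p. 1398] -/
theorem isOpen_ray_hasGlobalKatoSolution {ν : ℝ} (hν : 0 < ν)
    {u₀ : EuclideanSpace ℝ (Fin 3) → EuclideanSpace ℝ (Fin 3)} (hu₀ : MemLp u₀ 3 volume)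
    (hdiv : IsWeaklyDivFree u₀) :
    IsOpen {s : ℝ | HasGlobalKatoSolution ν (s • u₀)} := by
  rw [isOpen_iff_mem_nhds]
  intro x hx
  obtain ⟨ε, hε, hball⟩ := GIP2003_L3_stability_holds.exists_ball_hasGlobalKatoSolution hν
    (hu₀.const_smul x) (hdiv.const_smul x) hx
  set N : ℝ := (eLpNorm u₀ 3 volume).toReal with hN
  have hN0 : 0 ≤ N := ENNReal.toReal_nonneg
  have hNe : eLpNorm u₀ 3 volume = ENNReal.ofReal N := by
    rw [hN, ENNReal.ofReal_toReal hu₀.eLpNorm_ne_top]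
  have hρ : 0 < ε / (N + 1) := div_pos hε (by linarith)
  refine Metric.ball_mem_nhds x hρ |> Filter.mem_of_superset <| fun s hs => ?_
  refine hball (s • u₀) (hu₀.const_smul s) (hdiv.const_smul s) ?_
  rw [← sub_smul, eLpNorm_const_smul, hNe, ← ofReal_norm, Real.norm_eq_abs,
    ← ENNReal.ofReal_mul (abs_nonneg _)]
  refine (ENNReal.ofReal_lt_ofReal_iff hε).2 ?_
  have hxs : |x - s| < ε / (N + 1) := by
    rw [abs_sub_comm]; simpa [Real.dist_eq] using hs
  calc |x - s| * N ≤ ε / (N + 1) * N := mul_le_mul_of_nonneg_right hxs.le hN0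
    _ < ε := by
        rw [div_mul_eq_mul_div, div_lt_iff₀ (by linarith)]
        nlinarith

/-! ## The barrier: the CLOSED half is the whole problem -/

/-- **Closedness along one ray already gives regularity of that datum.** Let `ν > 0` and let
`u₀ ∈ L³(ℝ³)` be weakly divergence free. If the parameter set `{s : ℝ | s u₀ ∈ G_ν}` (data on the
ray through `u₀` with a global Kato solution) is CLOSED, then `u₀ ∈ G_ν`: the set is open (GIP
2003), closed (hypothesis) and contains `0` (Kato), so it is all of `ℝ` by connectedness, and
`1 • u₀ = u₀`. This is the honest form of «continuous induction on the data»: the induction closes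
iff the closedness step holds, and nothing weaker than the conclusion feeds that step.
[cite: GallagherIftimiePlanchon2003, Thm. 0.1 (p. 1389) and §3 p. 1398] -/
theorem hasGlobalKatoSolution_of_isClosed_ray {ν : ℝ} (hν : 0 < ν)
    {u₀ : EuclideanSpace ℝ (Fin 3) → EuclideanSpace ℝ (Fin 3)} (hu₀ : MemLp u₀ 3 volume)
    (hdiv : IsWeaklyDivFree u₀)
    (hclosed : IsClosed {s : ℝ | HasGlobalKatoSolution ν (s • u₀)}) :
    HasGlobalKatoSolution ν u₀ := by
  have hclopen : IsClopen {s : ℝ | HasGlobalKatoSolution ν (s • u₀)} :=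
    ⟨hclosed, isOpen_ray_hasGlobalKatoSolution hν hu₀ hdiv⟩
  have h0 : (0 : ℝ) ∈ {s : ℝ | HasGlobalKatoSolution ν (s • u₀)} := by
    simpa using hasGlobalKatoSolution_zero hν
  have huniv := hclopen.eq_univ ⟨0, h0⟩
  have h1 : (1 : ℝ) ∈ {s : ℝ | HasGlobalKatoSolution ν (s • u₀)} := by
    rw [huniv]; trivial
  simpa using h1

/-- **BARRIER (iff form): «every ray-section of `G_ν` is closed» ⇔ «every weakly divergence-free
`L³` datum has a global Kato solution».** So a proof of regularity by continuity in the data cannot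
cite the closedness of the good set as a lemma supported by anything short of the full a priori
control — it is equivalent to the theorem being proved; the OPEN half, by contrast, is free
(GIP 2003).

BARRIER (structured block, D-0021):
technique_class: continuity-method-in-data continuous-induction clopen-argument open-and-closed-set-of-good-data closed-range-open-map apriori-bound-uniform-on-bounded-data
blocks: proof schemes for NavierStokesRegularity (or for global regularity of `L³` / `Ḣ^{1/2}` / `H¹` data) of the shape «the set `G` of data (resp. of times, resp. the range of the solution map) with a global regular solution is non-empty, OPEN and CLOSED, hence everything», whenever the CLOSED step is justified by an a priori estimate with a data-independent constant or by «`sup_n C(u₀ₙ) < ∞`» for a convergent sequence of good data: by this theorem that step is equivalent to the conclusion for all data on the relevant rays (iff form here; Clay form `clayA_of_forall_isClosed_ray`), so the scheme has no content beyond its closedness estimate — which is where the typed instances break (NS-CLAIMS map D-0090: arXiv:1204.5040v2 §4 «`G_p` closed», `M = sup_n C[κ_p(u₀ₙ)] < ∞` from per-`n` finiteness — kernel `Summit.NavierStokesRegularity.NavierStokesRegularity.Theorems.Cui2012.not_Assertion2Inference`; arXiv:2009.10530v2 Thm. 3.1, closed range via (3.13) — kernel `…Theorems.ShlapunovTarkhanov2020.not_Ineq313Inference`);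 the OPEN step is never the obstacle: it is [cite: GallagherIftimiePlanchon2003, Thm. 0.1 (p. 1389) and §3 p. 1398] (tree `GIP2003_L3_stability_holds`), and a printed openness step that fails (arXiv:1204.5040v2 Assertion 1: a set cut out by a NON-strict bound with a fixed constant has no slack, `…Cui2012.not_Assertion1Inference`) fails only because the set was defined by the bound instead of by the property.
because: `{s | s u₀ ∈ G_ν}` is open for every weakly divergence-free `u₀ ∈ L³` (stability of global Kato solutions under `L³` perturbations of size `ε(u)`, `‖x u₀ − s u₀‖₃ = |x−s|‖u₀‖₃`) [cite: GallagherIftimiePlanchon2003, Thm. 0.1 (p. 1389)], contains `0` [cite: Kato1984MathZ, Thm. 2 (p. 472)], and `ℝ` is connected: closed ⇒ clopen ⇒ `= ℝ ∋ 1` (`hasGlobalKatoSolution_of_isClosed_ray`); conversely if all data are good every section is `ℝ`, closed.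
evasions_known: supply the closedness by a GENUINE a priori bound in a critical norm that is uniform on `L³`-bounded (or `Ḣ^{1/2}`-bounded) sets of data — none is known and any such bound is the regularity theorem itself by this file; conditional versions are legitimate and in the tree (Type-I / critical-norm blow-up criteria: `Literature.Analysis.FluidPDE.ess_endpoint`, `seregin_L3_blowup`, barrier `CriticalNormBlowupNecessity`), they convert closedness into «critical norms stay bounded», not into a proof; small-data closedness is trivial inside Kato's ball [cite: Kato1984MathZ, Thm. 2 (p. 472)].
scope_caveats: (a) `L³`/Kato class at fixed `ν > 0` on `ℝ³` (GIP's setting; `Ḣ^{1/2}` and Besov versions of stability are printed in the same paper, Thm. 3.1–3.2, not used here) [cite: GallagherIftimiePlanchon2003, Thm. 0.1 (p. 1389); Thm. 3.1–3.2 (pp. 1398–1399)]; (b) the ray `s ↦ s u₀` is the weakest closedness hypothesis; closedness under general `L³` limits implies it; (c) «good» = has a global KATO solution (`HasGlobalKatoSolution`); for smooth rapidly decaying data this is the Clay (A) conclusion (`clayA_of_forall_isClosed_ray`, via `clay_solution_of_hasGlobalKatoSolution_holds`) [cite: Kato1984MathZ, Thm. 4]; (d) a statement about the LOGICAL SHAPE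 of continuity arguments, silent about any specific estimate; time-continuation variants («the set of times up to which the solution is smooth is open and closed») reduce likewise to a blow-up criterion at the closedness step and are covered by the criteria cited under evasions, not by this file.
status: established (proved here from discharged tree facts)
[cite: GallagherIftimiePlanchon2003, Thm. 0.1 (p. 1389) and §3 p. 1398] -/
theorem forall_isClosed_ray_iff_forall_global {ν : ℝ} (hν : 0 < ν) :
    (∀ u₀ : EuclideanSpace ℝ (Fin 3) → EuclideanSpace ℝ (Fin 3), MemLp u₀ 3 volume →
        IsWeaklyDivFree u₀ → IsClosed {s : ℝ | HasGlobalKatoSolution ν (s • u₀)}) ↔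
      (∀ u₀ : EuclideanSpace ℝ (Fin 3) → EuclideanSpace ℝ (Fin 3), MemLp u₀ 3 volume →
        IsWeaklyDivFree u₀ → HasGlobalKatoSolution ν u₀) := by
  constructor
  · intro h u₀ hu₀ hdiv
    exact hasGlobalKatoSolution_of_isClosed_ray hν hu₀ hdiv (h u₀ hu₀ hdiv)
  · intro h u₀ hu₀ hdiv
    have : {s : ℝ | HasGlobalKatoSolution ν (s • u₀)} = univ :=
      eq_univ_of_forall fun s => h (s • u₀) (hu₀.const_smul s) (hdiv.const_smul s)
    rw [this]
    exact isClosed_univ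

/-! ## Clay form -/

/-- A continuous rapidly decaying field on `ℝ³` lies in `L³` (private copy of the helper in
`SmallDataGlobalRegularity`; `‖u₀(x)‖ ≤ C(1+‖x‖)⁻²`, `(1+‖x‖)⁻⁶ ∈ L¹(ℝ³)`). [folklore] -/
private theorem memLp_three_of_hasRapidSpatialDecay
    {u₀ : EuclideanSpace ℝ (Fin 3) → EuclideanSpace ℝ (Fin 3)} (hc : Continuous u₀)
    (hd : HasRapidSpatialDecay u₀) : MemLp u₀ 3 volume := by
  obtain ⟨C, hC⟩ := hd 0 2
  have hb : ∀ x, ‖u₀ x‖ ≤ C * (1 + ‖x‖) ^ (-(2 : ℝ)) := fun x => by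
    have h := hC x
    rw [norm_iteratedFDeriv_zero] at h
    have hpos : 0 < 1 + ‖x‖ := by positivity
    rw [Real.rpow_neg hpos.le, ← div_eq_mul_inv, le_div_iff₀ (by positivity), Real.rpow_two]
    linarith [h]
  have hC0 : 0 ≤ C := by
    have h := hC 0
    rw [norm_iteratedFDeriv_zero] at h
    exact le_trans (by positivity) h
  have hmeas : AEStronglyMeasurable u₀ volume := hc.aestronglyMeasurable
  refine (integrable_norm_rpow_iff hmeas (by norm_num) (by norm_num)).1 ?_
  have h6 : (Module.finrank ℝ (EuclideanSpace ℝ (Fin 3)) : ℝ) < 6 := by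
    rw [finrank_euclideanSpace_fin]; norm_num
  refine ((integrable_one_add_norm h6).const_mul (C ^ (3 : ℝ))).mono' ?_
    (Eventually.of_forall fun x => ?_)
  · exact (hc.norm.rpow_const fun _ => Or.inr (by norm_num)).aestronglyMeasurable
  · have hpos : 0 < 1 + ‖x‖ := by positivity
    rw [Real.norm_of_nonneg (by positivity), ENNReal.toReal_ofNat]
    calc ‖u₀ x‖ ^ (3 : ℝ) ≤ (C * (1 + ‖x‖) ^ (-(2 : ℝ))) ^ (3 : ℝ) :=
          Real.rpow_le_rpow (norm_nonneg _) (hb x) (by norm_num)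
      _ = C ^ (3 : ℝ) * (1 + ‖x‖) ^ (-(6 : ℝ)) := by
          rw [Real.mul_rpow hC0 (Real.rpow_nonneg hpos.le _), ← Real.rpow_mul hpos.le]
          norm_num

/-- **BARRIER (Clay form).** If, for a viscosity `ν > 0`, every ray-section
`{s | s u₀ ∈ G_ν}` of the set of `L³` data with a global Kato solution is closed, then every smooth
divergence-free rapidly decaying datum has a smooth bounded-energy solution of the unforced
Navier–Stokes equations on `ℝ³ × [0,∞)` — the conclusion of Clay (A) at that viscosity (Kato ⇒
Clay upgrade `clay_solution_of_hasGlobalKatoSolution_holds`). The closedness step of a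
continuity-in-data argument therefore carries the entire Millennium statement.
[cite: GallagherIftimiePlanchon2003, Thm. 0.1 (p. 1389) and §3 p. 1398] -/
theorem clayA_of_forall_isClosed_ray {ν : ℝ} (hν : 0 < ν)
    (hclosed : ∀ u₀ : EuclideanSpace ℝ (Fin 3) → EuclideanSpace ℝ (Fin 3), MemLp u₀ 3 volume →
        IsWeaklyDivFree u₀ → IsClosed {s : ℝ | HasGlobalKatoSolution ν (s • u₀)})
    (u₀ : EuclideanSpace ℝ (Fin 3) → EuclideanSpace ℝ (Fin 3)) (hsm : ContDiff ℝ (⊤ : ℕ∞) u₀)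
    (hdiv : NSWave0.IsDivFree u₀) (hdec : HasRapidSpatialDecay u₀) :
    ∃ (u : ℝ → EuclideanSpace ℝ (Fin 3) → EuclideanSpace ℝ (Fin 3))
      (p : ℝ → EuclideanSpace ℝ (Fin 3) → ℝ),
      IsSmoothOnHalfSpace u ∧ IsSmoothOnHalfSpace p ∧ IsNavierStokesSolution ν 0 u₀ u p ∧
        HasBoundedEnergy u := by
  have hL3 : MemLp u₀ 3 volume := memLp_three_of_hasRapidSpatialDecay hsm.continuous hdec
  have hwdf : IsWeaklyDivFree u₀ :=
    VectorCalculus.IsDivFree.isWeaklyDivFree_holds hdiv (hsm.of_le (by exact_mod_cast le_top))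
  have hK : HasGlobalKatoSolution ν u₀ :=
    (forall_isClosed_ray_iff_forall_global hν).1 hclosed u₀ hL3 hwdf
  exact clay_solution_of_hasGlobalKatoSolution_holds ν hν u₀ hsm hdiv hdec hK

end Literature.Barriers.NavierStokesRegularity
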